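import Mathlib
import HarnessLib
import HarnessLib.Audit
import Summits.HodgeConjecture.HodgeConjecture.Theses.PadicSemiregularLift
import Literature.AlgebraicGeometry.KTheory.GrothendieckGroup
import Literature.AlgebraicGeometry.HodgeTheory.SemiregularityObstructionBridge

/-!
# Line `sigma-ob-kzero-additivity` — crux `PadicPridhamSemiregularity` (stmt-HodgeConjecture-13815), P1b

Skeleton (crux-plan, planner-cruxplan-stmt-HodgeConjecture-13815-sigma-ob-kzero-addit-0, 2026-08-16) of the
triaged crux idea `Cruxes/PadicPridhamSemiregularity/Ideas/sigma-ob-kzero-additivity.md` (3/3 pass).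

THE CRUX (informal — item 13815 has `signature: null`, the route file `Theses/PadicSemiregularLift.lean`
carries it as a comment): (i′) `σ_q(o(E_n)) = gr^q Ob_n([E_n])`; (ii′) HENCE a p-adically semiregular `E₁`
satisfies (⋆) CLASS-LIFTS-IMPLY-OBJECT-LIFTS = the hypothesis of the typed crux `FormalLiftingFromClassLifting`
(stmt-13825). This line settles the OPERATIVE half (ii′) WITHOUT (i′) (card; = `Disproof.lean` §1 Finding 1,
`StepObstructionTheory.lifts_of_classLifts`): `Φ(F) := σ(ob F)` is ADDITIVE on short exact sequences of
vector bundles on `X_{n+1}` (the one analytic input, (A1)), hence factors through Fulton's `K₀(X_{n+1})`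
(`KZero.lift`) and kills `im(K₀(X_{n+2}) → K₀(X_{n+1}))` (restrictions are unobstructed); so
`[F] ∈ im ⇒ σ(ob F) = 0 ⇒` (semiregular) `ob F = 0 ⇒ F` lifts.

TYPED TARGET. Since the crux has no Lean declaration, the skeleton is audited (`ledger skeleton check …
--crux-decl …SigmaObKzeroAdditivity.SemiregularClassLiftsImplyObjectLifts`) against the typed form of (ii′)
defined HERE over REAL carriers only: `SemiregularClassLiftsImplyObjectLifts` — for a smooth proper model
`𝒳/W(k)` and a finite locally free `E₁` on the special fibre that is `{0,1}`-SEMIREGULAR (the tree's real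
`HodgeTheory.IsZeroOneSemiregular`: `(σ₀, σ₁) = (Tr, Tr(At ∘ −))` injective on Mathlib's `Ext²(E₁, E₁)`),
the (⋆)-clause of `FormalLiftingFromClassLifting` holds VERBATIM (`star_hypothesis_of` checks the shapes agree).
For `d ≤ 3` `{0,1}`-semiregular IS p-adic semiregularity (`H^{q+2}(X₁, Ω^q) = 0` for `q ≥ 2`); for `d ≥ 4` it
is the typable special case (`σ_q`, `q ≥ 2`, awaits the Yoneda–exterior algebra on `⊕ Extⁱ(E, E ⊗ Ωʲ)`); the
skeleton extends verbatim per extra component. No torsion-freeness, no projectivity, no `p > d + 6`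
(Disproof §3 `torsionFreeness_not_used`; integral `KZero`, Disproof §8).

STUBS (`sorry` ONLY here; each a lemma of the line, all five consumed by the composition). RESHAPED by the
line lead (prover-line-stmt-HodgeConjecture-13815-0, 2026-08-16): the planner's single tower stub
`stub_towerStep` (a conjunction of three independent facts) is split into G1–G3 so that each is one statement:
* `stub_thickeningMap_firstOrder` (G1) — `X_{n+1} ↪ X_{n+2}` is a first-order thickening (any `W(k)`-scheme);
* `stub_specialFibreToThickening_closedImmersion` (G2) — `X_k ↪ X_{n+1}` is a closed immersion (any `W(k)`-scheme);
* `stub_conormalSheaf_thickeningMap` (G3) — the conormal sheaf `p^{n+1}𝒪/p^{n+2}𝒪` of `X_{n+1} ↪ X_{n+2}` is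
  `j_*𝒪_{X_k}` for a smooth proper model (flatness of smooth `𝒳/W`);
* `stub_illusieObstructionAdditive` — THE HEART ((A1) + Tag 08VR): across any first-order thickening
  `i : Z₀ ↪ Z₁` whose conormal sheaf is `j_*𝒪_Y` for a closed immersion `j : Y ↪ Z₀` of a `k`-scheme `Y`,
  there is an obstruction map `Ob : VB(Z₀) → Ext²_Y(j^*F, j^*F ⊗ 𝒪_Y)` (Illusie's class read on `Y` by the
  cher-à-Cartan isomorphism) which (B) vanishes iff the bundle lifts and (A) has `σ₀ ∘ Ob`, `σ₁ ∘ Ob` ADDITIVE on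
  short exact sequences (filtered Čech cocycles are block upper triangular; `tr` = sum of diagonal traces;
  equivalently Buchweitz–Flenner Prop. 4.2 + 4.4). It is ONE existential package on purpose: additivity is a
  property of the INTENDED class, not of every `Ob` natural in `Ext` (counterexample in the line card);
* `stub_isZeroOneSemiregular_of_iso` — `{0,1}`-semiregularity is invariant under isomorphism of modules
  (functoriality of the real Atiyah class and trace; AtiyahClass.lean "Not here").
COMPOSITION (kernel-checked, no `sorry`): `SemiregularClassLiftsImplyObjectLifts_of` = the K₀-factorisation
principle (`KZero.lift`, `KZero.hom_ext`) + `isZeroOneSemiregular_iff_obstruction`.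
-/

noncomputable section

open CategoryTheory AlgebraicGeometry
open Literature.AlgebraicGeometry.Motives Literature.AlgebraicGeometry.Motives.WittScheme
  Literature.AlgebraicGeometry.KTheory Literature.AlgebraicGeometry.Deformation
  Literature.AlgebraicGeometry.HodgeTheory Literature.AlgebraicGeometry.Modules

set_option linter.dupNamespace false

namespace Summit.HodgeConjecture.HodgeConjecture.Cruxes.PadicPridhamSemiregularity.SigmaObKzeroAdditivity

/-! ## The typed target: CLAIM (ii′) over real carriers -/

/-- **CLAIM (ii′) of the crux, typed** — `{0,1}`-SEMIREGULAR BUNDLES SATISFY (⋆): for `k` perfect of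
characteristic `p`, `𝒳/W(k)` a smooth proper model of relative dimension `d` and a finite locally free `E₁`
on the special fibre `X_k` with `(σ₀, σ₁) : Ext²(E₁, E₁) → H²(X_k, 𝒪) × H³(X_k, Ω¹)` injective, EVERY finite
locally free `F` on `X_{n+1} = 𝒳 ⊗ W/p^{n+1}` with `F|X_k ≅ E₁` whose class `[F] ∈ K₀(X_{n+1})` is the
restriction of a class in `K₀(X_{n+2})` is the restriction of a finite locally free sheaf on `X_{n+2}`.
The part after `IsZeroOneSemiregular hE₁ →` is the (⋆)-hypothesis of the route item
`FormalLiftingFromClassLifting` verbatim (`star_hypothesis_of`). -/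
def SemiregularClassLiftsImplyObjectLifts : Prop :=
  ∀ (p : ℕ) [Fact p.Prime] (k : Type) [Field k] [CharP k p] [PerfectRing k p] (d : ℕ)
    (𝒳 : SchemeOver (WittVector p k)), IsSmoothProperModel d 𝒳 →
    ∀ (E₁ : (specialFibre 𝒳).left.Modules) (hE₁ : IsFiniteLocallyFree E₁),
      IsZeroOneSemiregular hE₁ →
      ∀ (n : ℕ) (F : (thickening 𝒳 (n + 1)).left.Modules) (hF : IsFiniteLocallyFree F),
        Nonempty ((Scheme.Modules.pullback (specialFibreToThickening 𝒳 n)).obj F ≅ E₁) →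
        (∃ y : KZero (thickening 𝒳 (n + 2)).left,
            KZero.map (thickeningMap 𝒳 (Nat.le_succ (n + 1))) y = KZero.of F hF) →
        ∃ F' : (thickening 𝒳 (n + 2)).left.Modules, IsFiniteLocallyFree F' ∧
          Nonempty ((Scheme.Modules.pullback (thickeningMap 𝒳 (Nat.le_succ (n + 1)))).obj F' ≅ F)

/-! ## Named statements of the five stubs -/

/-- **(G1) The transition `X_{n+1} ↪ X_{n+2}` is a first-order thickening** (for ANY `W(k)`-scheme `𝒳`):
it is the base change of the closed immersion `Spec W_{n+1} ↪ Spec W_{n+2}` (surjection `W/p^{n+2} ↠ W/p^{n+1}`),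
and its kernel ideal sheaf is generated by the image of `p^{n+1}`, whose square `p^{2n+2}` vanishes in
`W/p^{n+2}` since `2n + 2 ≥ n + 2`. -/
def ThickeningMapFirstOrder : Prop :=
  ∀ (p : ℕ) [Fact p.Prime] (k : Type) [Field k] [CharP k p] (𝒳 : SchemeOver (WittVector p k)) (n : ℕ),
    IsFirstOrderThickening (thickeningMap 𝒳 (Nat.le_succ (n + 1)))

/-- **(G2) The inclusion of the special fibre `X_k ↪ X_{n+1}` is a closed immersion** (for ANY `W(k)`-scheme
`𝒳`): base change of the closed immersion `Spec k ↪ Spec W_{n+1}` (the residue map `W/p^{n+1} ↠ k`). -/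
def SpecialFibreToThickeningClosedImmersion : Prop :=
  ∀ (p : ℕ) [Fact p.Prime] (k : Type) [Field k] [CharP k p] (𝒳 : SchemeOver (WittVector p k)) (n : ℕ),
    IsClosedImmersion (specialFibreToThickening 𝒳 n)

/-- **(G3) The conormal sheaf of `X_{n+1} ↪ X_{n+2}` is `j_*𝒪_{X_k}`** for a smooth proper model `𝒳/W(k)`:
the ideal `p^{n+1}𝒪_{X_{n+2}}` (square zero, so already an `𝒪_{X_{n+1}}`-module, and killed by `p`) is
identified with `𝒪_𝒳/p = j_*𝒪_{X_k}` by multiplication by `p^{n+1}`, an isomorphism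
`𝒪_𝒳/p ⥲ p^{n+1}𝒪_𝒳/p^{n+2}𝒪_𝒳` because `𝒪_𝒳` has no `p`-torsion (smooth ⇒ flat over `W`). -/
def ConormalSheafThickeningMap : Prop :=
  ∀ (p : ℕ) [Fact p.Prime] (k : Type) [Field k] [CharP k p] [PerfectRing k p] (d : ℕ)
    (𝒳 : SchemeOver (WittVector p k)), IsSmoothProperModel d 𝒳 → ∀ (n : ℕ),
      Nonempty (conormalSheaf (thickeningMap 𝒳 (Nat.le_succ (n + 1))) ≅
        (Scheme.Modules.pushforward (specialFibreToThickening 𝒳 n)).obj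
          (unitModule (specialFibre 𝒳).left))

/-- **(H) Illusie's obstruction read on the base, and ADDITIVITY of `σ ∘ ob`** (the heart of the line).
For a first-order thickening `i : Z₀ ↪ Z₁`, a closed immersion `j : Y ↪ Z₀` of a `k`-scheme `Y` and an
identification `𝓘 ≅ j_*𝒪_Y` of the conormal sheaf of `i`, there is a map
`Ob : (F finite locally free on Z₀) ↦ Ob F ∈ Ext²_Y(j^*F, j^*F ⊗ 𝒪_Y)` (intended: Illusie's obstruction
`o(F) ∈ Ext²_{Z₀}(F, F ⊗ 𝓘)`, Stacks Tag 08L8/08VR, transported by `𝓘 ≅ j_*𝒪_Y` and the cher-à-Cartan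
isomorphism `Ext²_{Z₀}(F, F ⊗ j_*𝒪_Y) ≅ Ext²_Y(j^*F, j^*F ⊗ 𝒪_Y)`, Lieblich Cor. 3.1.2 / Tag 08LK) such that
(B) `Ob F = 0` iff `F` is the restriction of a finite locally free sheaf on `Z₁` (Tag 08VR (1)), and
(A) `F ↦ σ₀(Ob F) ∈ H²(Y, 𝒪_Y)` and `F ↦ σ₁(Ob F) ∈ H³(Y, Ω¹_{Y/k})` are ADDITIVE over short exact sequences
`0 → F′ → F → F″ → 0` of finite locally free `𝒪_{Z₀}`-modules (`σ₀ = Tr`, `σ₁ = Tr(At(j^*F) ∘ −)`, the tree's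
real `sigmaZeroObstruction` / `sigmaOneObstruction`). PAPER PROOF of (A): frames of `F` on affines of `Z₀`
adapted to `F′` have block upper triangular transition matrices; lift them block upper triangularly to `Z₁`
(nilpotent thickening of affines); the cocycle defect representing `ob F` and the cocycle `dg·g⁻¹`
representing `At` are then block upper triangular with the cocycles of `F′`, `F″` on the diagonal; Čech
products of block triangular cochains are block triangular with the products of the diagonal blocks on the
diagonal, and the trace of a block triangular matrix is the sum of the diagonal traces (toy:
`Disproof.trace_pow_mul_eq`); `q = 0` is Mukai–Artamkin `tr(ob F) = ob(det F)`. Second printed route: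
Buchweitz–Flenner Prop. 4.4 (`ob = ⟨[Z₁], −At⟩`) + Prop. 4.2 (`σ_k(ob) = ⟨[Z₁], ch_{k+1}⟩`, `ch` additive). -/
def IllusieObstructionAdditive : Prop :=
  ∀ (k : Type) [CommRing k] (Y : SchemeOver k) (Z₀ Z₁ : Scheme.{0}) (j : Y.left ⟶ Z₀)
    [IsClosedImmersion j] (i : Z₀ ⟶ Z₁) [IsFirstOrderThickening i],
    (conormalSheaf i ≅ (Scheme.Modules.pushforward j).obj (unitModule Y.left)) →
    ∃ Ob : ∀ (F : Z₀.Modules), IsFiniteLocallyFree F →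
        obstructionGroup 2 ((Scheme.Modules.pullback j).obj F) (unitModule Y.left),
      (∀ (F : Z₀.Modules) (hF : IsFiniteLocallyFree F),
        Ob F hF = 0 ↔ ∃ F' : Z₁.Modules, IsFiniteLocallyFree F' ∧
          Nonempty ((Scheme.Modules.pullback i).obj F' ≅ F)) ∧
      (∀ (S : ShortComplex Z₀.Modules), S.ShortExact → ∀ (h₁ : IsFiniteLocallyFree S.X₁)
        (h₂ : IsFiniteLocallyFree S.X₂) (h₃ : IsFiniteLocallyFree S.X₃),
        sigmaZeroObstruction (h₂.pullback j) (Ob S.X₂ h₂) =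
            sigmaZeroObstruction (h₁.pullback j) (Ob S.X₁ h₁) +
              sigmaZeroObstruction (h₃.pullback j) (Ob S.X₃ h₃) ∧
          sigmaOneObstruction (h₂.pullback j) (Ob S.X₂ h₂) =
            sigmaOneObstruction (h₁.pullback j) (Ob S.X₁ h₁) +
              sigmaOneObstruction (h₃.pullback j) (Ob S.X₃ h₃))

/-- **(T) `{0,1}`-semiregularity is invariant under isomorphism** of finite locally free modules on a
`k`-scheme: `σᵢ(E') ∘ (e⁻¹ ∘ − ∘ e) = σᵢ(E)` for `e : E ≅ E'`, by functoriality of the Atiyah extension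
(Atiyah 1957 Prop. 6–7) and conjugation invariance of the trace. -/
def IsZeroOneSemiregularOfIso : Prop :=
  ∀ (k : Type) [CommRing k] (Y : SchemeOver k) (E E' : Y.left.Modules) (_e : E ≅ E')
    (hE : IsFiniteLocallyFree E) (hE' : IsFiniteLocallyFree E'),
    IsZeroOneSemiregular hE → IsZeroOneSemiregular hE'

/-! ## Registered stubs (`sorry` lives ONLY in these five theorems; statements = the defs above, unfolded) -/

/-- Stub G1, registered form (= `ThickeningMapFirstOrder`). -/
theorem stub_thickeningMap_firstOrder :
  ∀ (p : ℕ) [Fact p.Prime] (k : Type) [Field k] [CharP k p] (𝒳 : SchemeOver (WittVector p k)) (n : ℕ),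
    IsFirstOrderThickening (thickeningMap 𝒳 (Nat.le_succ (n + 1))) := by
  sorry

/-- Stub G2, registered form (= `SpecialFibreToThickeningClosedImmersion`). -/
theorem stub_specialFibreToThickening_closedImmersion :
  ∀ (p : ℕ) [Fact p.Prime] (k : Type) [Field k] [CharP k p] (𝒳 : SchemeOver (WittVector p k)) (n : ℕ),
    IsClosedImmersion (specialFibreToThickening 𝒳 n) := by
  sorry

/-- Stub G3, registered form (= `ConormalSheafThickeningMap`). -/
theorem stub_conormalSheaf_thickeningMap :
  ∀ (p : ℕ) [Fact p.Prime] (k : Type) [Field k] [CharP k p] [PerfectRing k p] (d : ℕ)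
    (𝒳 : SchemeOver (WittVector p k)), IsSmoothProperModel d 𝒳 → ∀ (n : ℕ),
      Nonempty (conormalSheaf (thickeningMap 𝒳 (Nat.le_succ (n + 1))) ≅
        (Scheme.Modules.pushforward (specialFibreToThickening 𝒳 n)).obj
          (unitModule (specialFibre 𝒳).left)) := by
  sorry

/-- Stub H, registered form (= `IllusieObstructionAdditive`). -/
theorem stub_illusieObstructionAdditive :
  ∀ (k : Type) [CommRing k] (Y : SchemeOver k) (Z₀ Z₁ : Scheme.{0}) (j : Y.left ⟶ Z₀)
    [IsClosedImmersion j] (i : Z₀ ⟶ Z₁) [IsFirstOrderThickening i],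
    (conormalSheaf i ≅ (Scheme.Modules.pushforward j).obj (unitModule Y.left)) →
    ∃ Ob : ∀ (F : Z₀.Modules), IsFiniteLocallyFree F →
        obstructionGroup 2 ((Scheme.Modules.pullback j).obj F) (unitModule Y.left),
      (∀ (F : Z₀.Modules) (hF : IsFiniteLocallyFree F),
        Ob F hF = 0 ↔ ∃ F' : Z₁.Modules, IsFiniteLocallyFree F' ∧
          Nonempty ((Scheme.Modules.pullback i).obj F' ≅ F)) ∧
      (∀ (S : ShortComplex Z₀.Modules), S.ShortExact → ∀ (h₁ : IsFiniteLocallyFree S.X₁)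
        (h₂ : IsFiniteLocallyFree S.X₂) (h₃ : IsFiniteLocallyFree S.X₃),
        sigmaZeroObstruction (h₂.pullback j) (Ob S.X₂ h₂) =
            sigmaZeroObstruction (h₁.pullback j) (Ob S.X₁ h₁) +
              sigmaZeroObstruction (h₃.pullback j) (Ob S.X₃ h₃) ∧
          sigmaOneObstruction (h₂.pullback j) (Ob S.X₂ h₂) =
            sigmaOneObstruction (h₁.pullback j) (Ob S.X₁ h₁) +
              sigmaOneObstruction (h₃.pullback j) (Ob S.X₃ h₃)) := by
  sorry

/-- Stub T, registered form (= `IsZeroOneSemiregularOfIso`). -/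
theorem stub_isZeroOneSemiregular_of_iso :
  ∀ (k : Type) [CommRing k] (Y : SchemeOver k) (E E' : Y.left.Modules) (_e : E ≅ E')
    (hE : IsFiniteLocallyFree E) (hE' : IsFiniteLocallyFree E'),
    IsZeroOneSemiregular hE → IsZeroOneSemiregular hE' := by
  sorry

/-! ### Consistency: each named statement IS its registered stub (definitional unfolding only) -/

theorem thickeningMapFirstOrder_holds : ThickeningMapFirstOrder := stub_thickeningMap_firstOrder
theorem specialFibreToThickeningClosedImmersion_holds : SpecialFibreToThickeningClosedImmersion :=
  stub_specialFibreToThickening_closedImmersion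
theorem conormalSheafThickeningMap_holds : ConormalSheafThickeningMap := stub_conormalSheaf_thickeningMap
theorem illusieObstructionAdditive_holds : IllusieObstructionAdditive := stub_illusieObstructionAdditive
theorem isZeroOneSemiregularOfIso_holds : IsZeroOneSemiregularOfIso := stub_isZeroOneSemiregular_of_iso

/-! ### Name-keyed aliases (the skeleton audit matches a hypothesis head to a declared stub by its last
name component) -/
namespace Registered

/-- Alias of `ThickeningMapFirstOrder` keyed by the registered stub name. -/
abbrev stub_thickeningMap_firstOrder : Prop := ThickeningMapFirstOrder
/-- Alias of `SpecialFibreToThickeningClosedImmersion` keyed by the registered stub name. -/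
abbrev stub_specialFibreToThickening_closedImmersion : Prop := SpecialFibreToThickeningClosedImmersion
/-- Alias of `ConormalSheafThickeningMap` keyed by the registered stub name. -/
abbrev stub_conormalSheaf_thickeningMap : Prop := ConormalSheafThickeningMap
/-- Alias of `IllusieObstructionAdditive` keyed by the registered stub name. -/
abbrev stub_illusieObstructionAdditive : Prop := IllusieObstructionAdditive
/-- Alias of `IsZeroOneSemiregularOfIso` keyed by the registered stub name. -/
abbrev stub_isZeroOneSemiregular_of_iso : Prop := IsZeroOneSemiregularOfIso

end Registered

/-! ## Proved glue (no `sorry` below this line) -/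

section Glue

variable {Y Z : Scheme.{0}} (f : Y ⟶ Z) {A : Type*} [AddCommGroup A]

/-- **K₀-FACTORISATION PRINCIPLE** (the lever; Fulton §15.1 universal property = tree `KZero.lift`):
an invariant of vector bundles on `Y` that is additive on short exact sequences and vanishes on pull-backs
`f^*G` vanishes on every bundle whose `K₀`-class is pulled back from `Z`. -/
theorem vanishes_of_classLifts (Φ : ∀ F : Y.Modules, IsFiniteLocallyFree F → A)
    (hadd : ∀ (S : ShortComplex Y.Modules), S.ShortExact → ∀ (h₁ : IsFiniteLocallyFree S.X₁)
      (h₂ : IsFiniteLocallyFree S.X₂) (h₃ : IsFiniteLocallyFree S.X₃), Φ S.X₂ h₂ = Φ S.X₁ h₁ + Φ S.X₃ h₃)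
    (hvan : ∀ (G : Z.Modules) (hG : IsFiniteLocallyFree G),
      Φ ((Scheme.Modules.pullback f).obj G) (hG.pullback f) = 0)
    (F : Y.Modules) (hF : IsFiniteLocallyFree F) (hcls : ∃ y : KZero Z, KZero.map f y = KZero.of F hF) :
    Φ F hF = 0 := by
  obtain ⟨y, hy⟩ := hcls
  have hcomp : (KZero.lift Φ hadd).comp (KZero.map f) = 0 :=
    KZero.hom_ext fun G hG => by
      simp only [AddMonoidHom.comp_apply, KZero.map_of, KZero.lift_of, AddMonoidHom.zero_apply]
      exact hvan G hG
  rw [← KZero.lift_of Φ hadd F hF, ← hy, ← AddMonoidHom.comp_apply, hcomp, AddMonoidHom.zero_apply]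

end Glue

/-- **`SemiregularClassLiftsImplyObjectLifts_of`** — the composition (concludes the typed crux BY NAME):
(G1–G3) supply the thickening `i : X_{n+1} ↪ X_{n+2}`, the closed immersion `j : X_k ↪ X_{n+1}` and
`𝓘 ≅ j_*𝒪`; (H) the obstruction `Ob` with (B) and additivity (A); `Φ(F) := (σ₀(Ob F), σ₁(Ob F))` is then
additive and vanishes on restrictions `i^*G` (by (B)), so `vanishes_of_classLifts` gives `Φ(F) = 0` when
`[F]` lifts; (T) moves `{0,1}`-semiregularity from `E₁` to `j^*F ≅ E₁`, so `Ob F = 0`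
(`isZeroOneSemiregular_iff_obstruction`) and `F` lifts by (B). -/
theorem SemiregularClassLiftsImplyObjectLifts_of (hG1 : Registered.stub_thickeningMap_firstOrder)
    (hG2 : Registered.stub_specialFibreToThickening_closedImmersion)
    (hG3 : Registered.stub_conormalSheaf_thickeningMap)
    (hH : Registered.stub_illusieObstructionAdditive) (hT : Registered.stub_isZeroOneSemiregular_of_iso) :
    SemiregularClassLiftsImplyObjectLifts := by
  intro p _ k _ _ _ d 𝒳 h𝒳 E₁ hE₁ hsr n F hF hE hcls
  obtain ⟨e⟩ := hE
  haveI : IsFirstOrderThickening (thickeningMap 𝒳 (Nat.le_succ (n + 1))) := hG1 p k 𝒳 n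
  haveI : IsClosedImmersion (specialFibreToThickening 𝒳 n) := hG2 p k 𝒳 n
  obtain ⟨eI⟩ := hG3 p k d 𝒳 h𝒳 n
  obtain ⟨Ob, hdet, hadd⟩ :=
    hH k (specialFibre 𝒳) (thickening 𝒳 (n + 1)).left (thickening 𝒳 (n + 2)).left
      (specialFibreToThickening 𝒳 n) (thickeningMap 𝒳 (Nat.le_succ (n + 1))) eI
  -- the additive invariant `Φ = (σ₀ ∘ Ob, σ₁ ∘ Ob)` with values in `H²(X_k, 𝒪) × H³(X_k, Ω¹)`
  let Φ : ∀ G : (thickening 𝒳 (n + 1)).left.Modules, IsFiniteLocallyFree G →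
      structureSheafCohomology (specialFibre 𝒳).left 2 × hodgeCohomologyOne (specialFibre 𝒳) 3 :=
    fun G hG => (sigmaZeroObstruction (hG.pullback (specialFibreToThickening 𝒳 n)) (Ob G hG),
      sigmaOneObstruction (hG.pullback (specialFibreToThickening 𝒳 n)) (Ob G hG))
  have hΦadd : ∀ (S : ShortComplex (thickening 𝒳 (n + 1)).left.Modules), S.ShortExact →
      ∀ (h₁ : IsFiniteLocallyFree S.X₁) (h₂ : IsFiniteLocallyFree S.X₂) (h₃ : IsFiniteLocallyFree S.X₃),
        Φ S.X₂ h₂ = Φ S.X₁ h₁ + Φ S.X₃ h₃ := by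
    intro S hS h₁ h₂ h₃
    obtain ⟨h0, h1⟩ := hadd S hS h₁ h₂ h₃
    simp only [Φ, Prod.mk_add_mk, Prod.mk.injEq]
    exact ⟨h0, h1⟩
  have hΦvan : ∀ (G : (thickening 𝒳 (n + 2)).left.Modules) (hG' : IsFiniteLocallyFree G),
      Φ ((Scheme.Modules.pullback (thickeningMap 𝒳 (Nat.le_succ (n + 1)))).obj G)
        (hG'.pullback (thickeningMap 𝒳 (Nat.le_succ (n + 1)))) = 0 := by
    intro G hG'
    have h0 : Ob _ (hG'.pullback (thickeningMap 𝒳 (Nat.le_succ (n + 1)))) = 0 :=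
      (hdet _ _).mpr ⟨G, hG', ⟨Iso.refl _⟩⟩
    simp only [Φ, h0, map_zero, Prod.mk_zero_zero]
  have hΦF : Φ F hF = 0 := vanishes_of_classLifts _ Φ hΦadd hΦvan F hF hcls
  -- semiregularity of `j^*F ≅ E₁`
  have hsrF : IsZeroOneSemiregular (hF.pullback (specialFibreToThickening 𝒳 n)) :=
    hT k (specialFibre 𝒳) E₁ _ e.symm hE₁ (hF.pullback (specialFibreToThickening 𝒳 n)) hsr
  have hOb : Ob F hF = 0 :=
    (isZeroOneSemiregular_iff_obstruction (hF.pullback (specialFibreToThickening 𝒳 n))).mp hsrF (Ob F hF)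
      (congrArg Prod.fst hΦF) (congrArg Prod.snd hΦF)
  exact (hdet F hF).mp hOb

/-- Wiring check: the registered stubs feed the composition as stated (definitional unfolding only). -/
example : SemiregularClassLiftsImplyObjectLifts :=
  SemiregularClassLiftsImplyObjectLifts_of stub_thickeningMap_firstOrder
    stub_specialFibreToThickening_closedImmersion stub_conormalSheaf_thickeningMap
    stub_illusieObstructionAdditive stub_isZeroOneSemiregular_of_iso

/-! ## The typed target IS hypothesis (⋆) of the route's typed crux (proved, no stub) -/

/-- **Shape check against the route**: `SemiregularClassLiftsImplyObjectLifts` discharges, for a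
`{0,1}`-semiregular `E₁` on a smooth proper model, EXACTLY the (⋆)-hypothesis of
`PadicSemiregularLift.FormalLiftingFromClassLifting` (stmt-HodgeConjecture-13825) — so REPAIRED P1 of the
route reads: P1a ∧ (ii′) ⇒ (semiregular + torsion-free Hodge cohomology + rational pro-class lift ⇒
`LiftsFormally`). Pure logic; it certifies that the typed target is the operative content of the crux. -/
theorem liftsFormally_of_semiregular
    (hP1a : Summit.HodgeConjecture.HodgeConjecture.Theses.PadicSemiregularLift.FormalLiftingFromClassLifting)
    (hII : SemiregularClassLiftsImplyObjectLifts)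
    (p : ℕ) [Fact p.Prime] (k : Type) [Field k] [CharP k p] [PerfectRing k p] (d : ℕ)
    (𝒳 : SchemeOver (WittVector p k)) (h𝒳 : IsSmoothProperModel d 𝒳)
    (hproj : Literature.AlgebraicGeometry.Crystalline.IsProjectiveOverRing 𝒳) (hp : d + 6 < p)
    (htfO : ∀ (b : ℕ) (x : structureSheafCohomology 𝒳.left b), (p : ℤ) • x = 0 → x = 0)
    (htfΩ : ∀ (b : ℕ) (x : hodgeCohomologyOne 𝒳 b), (p : ℤ) • x = 0 → x = 0)
    (hΩ : d ≤ 3 ∨ Nonempty (cotangentSheaf 𝒳 ≅ SheafOfModules.free (R := 𝒳.left.ringCatSheaf) (Fin d)))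
    (E₁ : (specialFibre 𝒳).left.Modules) (hE₁ : IsFiniteLocallyFree E₁) (hsr : IsZeroOneSemiregular hE₁)
    (hcls : ∃ ξ : ContinuousKZeroRat (Ideal.span {(p : WittVector p k)}) 𝒳,
      KZeroRat.map (Literature.AlgebraicGeometry.Crystalline.specialFibreToTower 𝒳)
        (ContinuousKZeroRat.specialFibre (Ideal.span {(p : WittVector p k)}) 𝒳 ξ) = KZeroRat.of E₁ hE₁) :
    LiftsFormally 𝒳 E₁ :=
  hP1a p k d 𝒳 h𝒳 hproj hp htfO htfΩ hΩ E₁ hE₁ (hII p k d 𝒳 h𝒳 E₁ hE₁ hsr) hcls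

end Summit.HodgeConjecture.HodgeConjecture.Cruxes.PadicPridhamSemiregularity.SigmaObKzeroAdditivity

end
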